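import Summits.ABC.IUTFork.Cor312SoundInput
import HarnessLib

/-!
# [IUTchIII] Cor. 3.12, Step (xi-f) — the PILOT-STRIP reading is the Corollary (circularity made kernel-visible)

Record-only file (D-0012) of the abc-iut cell (Cor. 3.12 STRATEGY TEAM A «direct III§3», D-0067, seat
abc-iut-c312-9 = A1, row A-4 of `HOME/plan/C312-TEAMS.md`); TAKES NO SIDE. It answers the
quantifier-level evidence of `Cor312SoundInputSeparation` (w5-d211, D-G-c312-9-1 row 2026-08-26T00:34:00Z:
"either flag the ∀-input quantifier STRONGER-THAN-PRINT, or pin the off-pilot binders") with a DICHOTOMY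
THEOREM instead of a label. Step (xi-f) ([IUTchIII] kurims p. 184 l. 19–29) says the construction "is
subject to the condition that [it] constitutes … a construction … of `−|log(q)|`"; there are exactly two
readings of that condition over the frozen `Cor312.Setting`:

* §1 **the PILOT-STRIP reading** `SoundAtPilot` — the condition demanded at the ONE input strip the
  Corollary names (`o := P.thetaPilot`). KERNEL FACT (§2, at EVERY frozen setting and EVERY value-group
  gluing, not only the toy/subsingleton settings of `Cor312SoundInputChecks`/`…Separation`):
  `soundAtPilot_iff_statement : SoundAtPilot P G ↔ P.Statement` — under this reading the (xi-f) premise IS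
  the printed conclusion, so "the inclusion … then follows formally" is formally true and CONTENTLESS
  (`soundAtPilot_of_statement` recovers the premise from the conclusion: a circle, exactly skel XXIV's
  "over the frozen Setting the weakest global volume statement implying the Corollary is the Corollary").
* §3 **the ALGORITHM reading** `SoundAtInput` (the GapA of record, G-c312-9-1) decomposes EXACTLY as
  pilot strip + off-pilot content: `SoundOffPilot` (§1) and
  `soundAtInput_iff_pilot_and_offPilot : SoundAtInput P G ↔ SoundAtPilot P G ∧ SoundOffPilot P G`, hence
  `soundAtInput_iff_statement_and_offPilot : SoundAtInput P G ↔ P.Statement ∧ SoundOffPilot P G` — the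
  content of GapA beyond the Corollary is PRECISELY the off-pilot conjunct, which is where w5-d211's
  binder-dependence (`soundAtInput_depends_on_gluing`, free `thetaRegionOf`/`linkMap` off the pilot)
  lives. Their subsingleton collapse is the degenerate case `SoundOffPilot` vacuous
  (`soundOffPilot_of_subsingleton`).

CONSEQUENCE for the GAP-LEDGER row (recorded there, not asserted here): the ∀-input form is not a
gratuitous strengthening — it is the ONLY non-circular reading available over the frozen types (the
pilot-strip alternative is the Corollary verbatim, by `soundAtPilot_iff_statement`); whether print's
Thm 3.11 algorithm licenses the off-pilot conjunct at the assembled real setting is exactly the disputed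
inference (Scholze–Stix §2.2 deny it; Yamashita Cor 13.13 asserts it), and w5-d211's alternative — pinning
`thetaRegionOf` off the pilot to the Kummer images of Thm 3.11 (ii) — remains the right refinement for the
REAL assembly, orthogonal to this dichotomy. [claim: Mochizuki2012, status: disputed]
[cite: ScholzeStix2018, §2.2 pp. 9–10] [cite: Yamashita2024IUTSurvey, Cor 13.13 proof, printed p. 360]
Deliberately NOT here: any claim that `SoundAtInput`/`SoundOffPilot` holds or fails at an instantiated
setting; any judgement on (xi-f).
-/

noncomputable section

namespace Summit.ABC

namespace IUTFork

namespace Cor312Vol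

open Thm311 Cor312 Literature.IUT.LogThetaLattice

variable {T : ThetaIndex} {S : Situation T} (P : Cor312.Setting S)

/-! ## 1. The two pieces of the (xi-f) condition -/

/-- **The PILOT-STRIP reading of Step (xi-f)**: the soundness condition demanded only at the one input
strip the Corollary names, `o := P.thetaPilot` ([IUTchIII] p. 184 l. 19–29 names one Θ-pilot strip; this
is the reading under which "the inclusion … then follows formally"). `soundAtPilot_iff_statement` shows it
is the printed Statement verbatim — the reading is CIRCULAR, which is the point of this file, not a
defect of the definition. [claim: Mochizuki2012, status: disputed] -/
@[claim "Mochizuki2012" "disputed"] def SoundAtPilot (G : LinkGluing P) : Prop :=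
  negLogThetaAt P P.thetaPilot ≠ ⊤ ∧
    ((negLogQAt P (G.linkMap P.thetaPilot) : ℝ) : WithTop ℝ) ≤ negLogThetaAt P P.thetaPilot

/-- **The OFF-PILOT content of GapA**: soundness of the multiradial algorithm at every input OTHER than
the Θ-pilot strip. This is where the entire content of `SoundAtInput` beyond the printed Corollary lives
(`soundAtInput_iff_statement_and_offPilot`), and where the free binders named by w5-d211
(`Setting.thetaRegionOf m o` for `o ≠ thetaPilot`, `G.linkMap` off the pilot) enter.
[claim: Mochizuki2012, status: disputed] -/
@[claim "Mochizuki2012" "disputed"] def SoundOffPilot (G : LinkGluing P) : Prop :=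
  ∀ o : P.Ob P.sig.Clgp, o ≠ P.thetaPilot →
    negLogThetaAt P o ≠ ⊤ ∧
      ((negLogQAt P (G.linkMap o) : ℝ) : WithTop ℝ) ≤ negLogThetaAt P o

/-! ## 2. The pilot-strip reading is the Corollary — at every setting, every gluing -/

/-- **CIRCULARITY, KERNEL-VISIBLE**: at EVERY frozen setting and EVERY value-group gluing, the pilot-strip
reading of the (xi-f) condition is EQUIVALENT to the printed Statement (rewrite along the definitional
`negLogThetaAt_thetaPilot`, the gluing law `G.link_thetaPilot`, and `negLogQAt_qPilot`). Generalises the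
object-blind collapse of `Cor312SoundInputChecks` and the subsingleton collapse of
`Cor312SoundInputSeparation` from their special settings to ALL of them: no hypothesis on `P` or `G`.
[folklore] -/
theorem soundAtPilot_iff_statement (G : LinkGluing P) : SoundAtPilot P G ↔ P.Statement := by
  constructor
  · rintro ⟨hfin, hle⟩
    rw [negLogThetaAt_thetaPilot] at hfin hle
    rw [G.link_thetaPilot, negLogQAt_qPilot] at hle
    exact ⟨hfin, hle⟩
  · rintro ⟨hfin, hle⟩
    refine ⟨?_, ?_⟩
    · rw [negLogThetaAt_thetaPilot]
      exact hfin
    · rw [negLogThetaAt_thetaPilot, G.link_thetaPilot, negLogQAt_qPilot]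
      exact hle

/-- Under the pilot-strip reading the (xi-f) inference "follows formally" — because the premise is the
conclusion (`soundAtPilot_iff_statement`). Forward direction, for the record. [folklore] -/
theorem statement_of_soundAtPilot (G : LinkGluing P) (h : SoundAtPilot P G) : P.Statement :=
  (soundAtPilot_iff_statement P G).mp h

/-- The circle closed: the pilot-strip premise is RECOVERED from the printed conclusion — the reading has
no content beyond the Corollary. (Contrast: `Cor312SoundInputSeparation.statement_not_imp_soundAtInput`
shows the ∀-input reading is NOT so recoverable.) [folklore] -/
theorem soundAtPilot_of_statement (G : LinkGluing P) (h : P.Statement) : SoundAtPilot P G :=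
  (soundAtPilot_iff_statement P G).mpr h

/-! ## 3. GapA = the Corollary ∧ the off-pilot content -/

/-- GapA restricted to the pilot strip (instantiate the ∀ at `o := P.thetaPilot`). [folklore] -/
theorem soundAtPilot_of_soundAtInput (G : LinkGluing P) (h : SoundAtInput P G) : SoundAtPilot P G :=
  h P.thetaPilot

/-- **THE DECOMPOSITION**: the ∀-input GapA of record is EXACTLY the pilot-strip reading plus the
off-pilot content — no more, no less. [folklore] -/
theorem soundAtInput_iff_pilot_and_offPilot (G : LinkGluing P) :
    SoundAtInput P G ↔ SoundAtPilot P G ∧ SoundOffPilot P G := by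
  constructor
  · intro h
    exact ⟨h P.thetaPilot, fun o _ => h o⟩
  · rintro ⟨hp, ho⟩ o
    by_cases hcase : o = P.thetaPilot
    · rw [hcase]
      exact hp
    · exact ho o hcase

/-- **THE DICHOTOMY, FINAL FORM**: `SoundAtInput P G ↔ P.Statement ∧ SoundOffPilot P G` — the content of
the gap statement of record beyond the printed Corollary is PRECISELY the off-pilot conjunct. Read with
w5-d211's `statement_not_imp_soundAtInput` (the off-pilot conjunct is not free) and
`soundAtInput_depends_on_gluing` (it sits on the off-pilot binders), this answers the G1′-flag question:
the ∀-input form is not a strengthening OF the printed condition but the only reading of it with content;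
the pilot-strip reading is the Corollary verbatim. [folklore] -/
theorem soundAtInput_iff_statement_and_offPilot (G : LinkGluing P) :
    SoundAtInput P G ↔ P.Statement ∧ SoundOffPilot P G := by
  rw [soundAtInput_iff_pilot_and_offPilot, soundAtPilot_iff_statement]

/-- Degenerate case, recovering `Cor312SoundInputSeparation.soundAtInput_iff_statement_of_subsingleton`
through the decomposition: with at most one object the off-pilot conjunct is vacuous. [folklore] -/
theorem soundOffPilot_of_subsingleton (G : LinkGluing P)
    (hsub : Subsingleton (P.Ob P.sig.Clgp)) : SoundOffPilot P G :=
  fun o ho => absurd (hsub.elim o P.thetaPilot) ho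

end Cor312Vol

end IUTFork

end Summit.ABC

end

/-!
## Provenance erratum (2026-08-26, A1/abc-iut-c312-9 gen 2; disclosure STATUS 01:06:30Z)

Written WITHOUT knowledge of skel XXVc `ForkInputPowers.lean`, which landed FIRST the same hour and already
contains the kernel content of §§2–3 in inline form: `soundAtThetaPilot_iff_statement` (= the hypothesis-free
pilot-instance ↔ `Statement` of `soundAtPilot_iff_statement` here, stated without the named `SoundAtPilot`) and
`soundAtInput_iff` (= `soundAtInput_iff_statement_and_offPilot` here, off-pilot conjunct inline). Cite XXVc
FIRST; this file's surplus is the NAMED level Props `SoundAtPilot` / `SoundOffPilot` (citable FQNs for the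
GAP-LEDGER row's LEVEL 0 / LEVEL 1), the one-liner pair, and `soundOffPilot_of_subsingleton`. The module
docstring's "generalises the object-blind and subsingleton collapses" describes the mathematics but NOT its
priority — XXVc generalised them first. Further context adopted by the row owner: skel finding #2 with ref
lane-R print verification (STATUS 00:30:01Z (3)) — the ∀-input form asserts N-tensor-power instances print
itself rejects ([IUTchIII] Step (xi-h) p. 185 l. 48–58; `InputPowers.fork`, XXVc) — so the dichotomy reads:
pilot instance = the Corollary (circular), ∀-input = beyond print's claim; the row carries both levels
(A2 supplement) and ref-b §4(ii) makes the label call.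
-/
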